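import Summits.MatrixMultiplication.OmegaCensus.DicyclicQuotientLift
import Summits.MatrixMultiplication.OmegaCensus.TPPSaturation
import Summits.MatrixMultiplication.OmegaCensus.DihedralLawModOneRankThreeAll
import HarnessLib

/-!
# Descent of `ρ(c₀)`-stable TPP triples to the dihedral quotient; no two-domino dicyclic-law triple when `A/⟨c₀⟩` has `2`-rank `≥ 3`

ω-census `pub-omega`, family (b3), seat pub-omega-group gen 11.  Framing: lottery ticket; floor = certified bounds/negative
ranges.  VALUE: kernel theorems about the group-theoretic method (TPP capacity of dihedral-like groups); NOT progress on ω.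

Dicyclic type `G(A, c₀)`, `c₀ ≠ 0`, `z = ρ(c₀)` the central involution, `π : A →+ B` onto with kernel `{0, c₀}` (so
`G(A,c₀)/⟨z⟩ ≅ G(B, 0) = Dih(B)`).  The companion file `DicyclicQuotientLift` lifts TPP triples of `Dih(B)` (volume `×2`).
Here the converse mechanism:

* `DihedralLikeGroup.tpp_image_of_stable` / `tpp_descend`: if `(S, T, U)` is a TPP triple of `G(A, c₀)` (all three non-empty)
  with `U z = U`, then the image `(S̄, T̄, Ū)` in `Dih(B)` is a TPP triple with `|S̄| = |S|`, `|T̄| = |T|`, `2|Ū| = |U|` (half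
  the volume), and the coset parts of `S̄, T̄, Ū` are the `π`-images of the coset parts.  (If the product of the three quotients
  lies in the kernel `{1, z}` and equals `z`, replacing `u'` by `u'z ∈ U` gives a genuine TPP relation; `f` is injective on
  `S` and `T` because `s' = sz` would give the relation `z · 1 · z = 1`.)  Stated for ANY central involution `ρ(z₀)`,
  `2z₀ = 0 ≠ z₀`, and `π` with kernel `{0, z₀}`, target `G(B, π c₀)` (dicyclic again when `z₀ ≠ c₀`): the census finds
  dicyclic-law triples with no `ρ(c₀)`-stable member but a `ρ(z₀)`-stable one (e.g. in `ℤ₁₀ ⋊ ℤ₄`, `z₀ = (0,5)`).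
* `two_domino_volume_le_double` (the conjectural `β(G(A,c₀)) = 2β(Dih(A/⟨c₀⟩))`, proved for two-domino triples): if `S`, `T`
  meet each coset in exactly one element, then `Dih(B)` has a TPP triple `(S̄, T̄, U')`, again with two dominoes, and
  `|S||T||U| ≤ 2 · |S̄||T̄||U'|` (saturate `U` by `z` — `tpp_saturate` — then descend).
* `no_two_domino_dicyclic_law_of_rank_three`: if moreover `|A| ≡ 2 (mod 3)`, `|A| ≥ 28` and `B` maps onto `𝔽₂³`, then no
  two-domino triple attains the dicyclic law `3|S||T||U| + 16 = 8|A|` — it would descend to a mod-one law triple of `Dih(B)`,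
  excluded by `no_mod_one_law_of_rank_three`.  This settles the two-domino ('P1') class of the open `|A| ≡ 2 (mod 3)`
  classification for the census families `C₂² × Q_{4m}` (`m ≡ 4 (mod 6)`), `C₂² × (ℤ_n ⋊ ℤ₄)` (`n ≡ 4 (mod 6)`),
  `C₂³ × Q_{4m}` (`m ≡ 2 (mod 3)`), whose quotients `ℤ₂² × ℤ_m`, `ℤ₂² × ℤ_n`, `ℤ₂³ × ℤ_m` map onto `𝔽₂³`.
-/

namespace Summit.MatrixMultiplication.OmegaCensus

open Literature.Combinatorics.Additive Finset

/-! ## Descent in the model -/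

namespace DihedralLikeGroup

variable {A B : Type} [AddCommGroup A] [AddCommGroup B] {c₀ : A} {c₀' : B}
  [Fact (c₀ + c₀ = 0)] [Fact (c₀' + c₀' = 0)] [DecidableEq A] [DecidableEq B]

omit [DecidableEq A] in
/-- `ρ(a)` is central in the model when `2a = 0` (e.g. `a = c₀`). [folklore] -/
theorem rho_comm_of_two {a : A} (h2 : a + a = 0) (g : DihedralLikeGroup A c₀) : rho a * g = g * rho a := by
  cases g with
  | rho b => rw [rho_mul_rho, rho_mul_rho, add_comm]
  | tau b =>
    rw [rho_mul_tau, tau_mul_rho]; congr 1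
    rw [sub_eq_iff_eq_add, add_assoc, h2, add_zero]

omit [DecidableEq A] in
/-- `ρ(a)² = 1` in the model when `2a = 0`. [folklore] -/
theorem rho_sq_of_two {a : A} (h2 : a + a = 0) : (rho a : DihedralLikeGroup A c₀) * rho a = 1 := by
  rw [rho_mul_rho, h2, one_def]

/-- **Descent of a `ρ(a)`-stable TPP triple along a homomorphism with kernel `{1, ρ(a)}`** (`2a = 0 ≠ a`, so `z = ρ(a)` is a
central involution; the basic case is `a = c₀`).  `f : G(A,c₀) →* G(B,c₀')` with kernel `{1, ρ(a)}`; a TPP triple `(S, T, U)`,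
all three sets non-empty, with `U ρ(a) = U`.  Then `(f S, f T, f U)` is a TPP triple, `f` is injective on `S` and on `T`, and
`2 |f U| = |U|`. [folklore] -/
theorem tpp_image_of_stable (f : DihedralLikeGroup A c₀ →* DihedralLikeGroup B c₀') {a : A} (ha2 : a + a = 0) (ha0 : a ≠ 0)
    (hker : ∀ g : DihedralLikeGroup A c₀, f g = 1 ↔ g = 1 ∨ g = rho a)
    {S T U : Finset (DihedralLikeGroup A c₀)} (h : TripleProductProperty S T U) (hS : S.Nonempty) (hT : T.Nonempty)
    (hU : U.Nonempty) (hUz : ∀ u ∈ U, u * rho a ∈ U) :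
    TripleProductProperty (S.image f) (T.image f) (U.image f) ∧
      (S.image f).card = S.card ∧ (T.image f).card = T.card ∧ 2 * (U.image f).card = U.card := by
  set z : DihedralLikeGroup A c₀ := rho a with hz
  have hzz : z * z = 1 := rho_sq_of_two ha2
  have hzinv : z⁻¹ = z := inv_eq_of_mul_eq_one_right hzz
  have hz1 : z ≠ 1 := by
    rw [hz, one_def]; intro h; exact ha0 (rho_injective h)
  have hfz : f z = 1 := (hker z).2 (Or.inr rfl)
  have comm : ∀ g : DihedralLikeGroup A c₀, z * g = g * z := rho_comm_of_two ha2
  have E1 : ∀ g : DihedralLikeGroup A c₀, (g * z)⁻¹ = g⁻¹ * z := fun g => by rw [mul_inv_rev, hzinv, comm]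
  have hker' : ∀ g : DihedralLikeGroup A c₀, f g = 1 → g = 1 ∨ g = z := fun g hg => (hker g).1 hg
  -- the key relation: `q₁ q₂ (u u'⁻¹) = z` is the TPP relation for `u, u'z`
  have twist : ∀ s ∈ S, ∀ s' ∈ S, ∀ t ∈ T, ∀ t' ∈ T, ∀ u ∈ U, ∀ u' ∈ U,
      s * s'⁻¹ * (t * t'⁻¹) * (u * u'⁻¹) = z → s = s' ∧ t = t' ∧ u = u' * z := by
    intro s hs s' hs' t ht t' ht' u hu u' hu' heq
    have heq' : s * s'⁻¹ * (t * t'⁻¹) * (u * (u' * z)⁻¹) = 1 := by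
      rw [E1, ← mul_assoc u, ← mul_assoc (s * s'⁻¹ * (t * t'⁻¹)), heq, hzz]
    exact h s hs s' hs' t ht t' ht' u hu (u' * z) (hUz u' hu') heq'
  -- `x (x z)⁻¹ · y y⁻¹ · w (w z)⁻¹ = 1` and `x x⁻¹ · y (y z)⁻¹ · w (w z)⁻¹ = 1`
  have rel₁ : ∀ x y w : DihedralLikeGroup A c₀, x * (x * z)⁻¹ * (y * y⁻¹) * (w * (w * z)⁻¹) = 1 := fun x y w => by
    rw [E1, mul_inv_cancel_left, mul_inv_cancel, mul_one, E1, mul_inv_cancel_left, hzz]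
  have rel₂ : ∀ x y w : DihedralLikeGroup A c₀, x * x⁻¹ * (y * (y * z)⁻¹) * (w * (w * z)⁻¹) = 1 := fun x y w => by
    rw [E1, mul_inv_cancel_left, mul_inv_cancel, one_mul, E1, mul_inv_cancel_left, hzz]
  obtain ⟨s₀, hs₀⟩ := hS
  obtain ⟨t₀, ht₀⟩ := hT
  obtain ⟨u₀, hu₀⟩ := hU
  -- `f x = f x'` inside one set forces `x' = x` or `x' = x z`
  have fib : ∀ x x' : DihedralLikeGroup A c₀, f x = f x' → x' = x ∨ x' = x * z := by
    intro x x' hxx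
    have hg : f (x⁻¹ * x') = 1 := by rw [map_mul, map_inv, hxx, inv_mul_cancel]
    rcases hker' _ hg with h1 | h1
    · left; exact (inv_mul_eq_one.1 h1).symm
    · right; rw [← h1, mul_inv_cancel_left]
  refine ⟨?_, ?_, ?_, ?_⟩
  · intro x hx x' hx' y hy y' hy' w hw w' hw' heq
    obtain ⟨s, hs, rfl⟩ := mem_image.1 hx
    obtain ⟨s', hs', rfl⟩ := mem_image.1 hx'
    obtain ⟨t, ht, rfl⟩ := mem_image.1 hy
    obtain ⟨t', ht', rfl⟩ := mem_image.1 hy'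
    obtain ⟨u, hu, rfl⟩ := mem_image.1 hw
    obtain ⟨u', hu', rfl⟩ := mem_image.1 hw'
    have hg : f (s * s'⁻¹ * (t * t'⁻¹) * (u * u'⁻¹)) = 1 := by
      simpa only [map_mul, map_inv] using heq
    rcases hker' _ hg with h1 | h1
    · obtain ⟨rfl, rfl, rfl⟩ := h s hs s' hs' t ht t' ht' u hu u' hu' h1
      exact ⟨rfl, rfl, rfl⟩
    · obtain ⟨rfl, rfl, rfl⟩ := twist s hs s' hs' t ht t' ht' u hu u' hu' h1
      exact ⟨rfl, rfl, by rw [map_mul, hfz, mul_one]⟩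
  · -- `f` injective on `S`
    refine card_image_of_injOn fun s hs s' hs' hss => ?_
    rcases fib s s' hss with h1 | h1
    · exact h1.symm
    · obtain ⟨hss', -, -⟩ := h s hs s' hs' t₀ ht₀ t₀ ht₀ u₀ hu₀ (u₀ * z) (hUz u₀ hu₀) (by rw [h1]; exact rel₁ s t₀ u₀)
      exact hss'
  · -- `f` injective on `T`
    refine card_image_of_injOn fun t ht t' ht' htt => ?_
    rcases fib t t' htt with h1 | h1
    · exact h1.symm
    · obtain ⟨-, htt', -⟩ := h s₀ hs₀ s₀ hs₀ t ht t' ht' u₀ hu₀ (u₀ * z) (hUz u₀ hu₀) (by rw [h1]; exact rel₂ s₀ t u₀)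
      exact htt'
  · -- the fibres of `f` on `U` are the pairs `{u, u z}`
    rw [card_eq_sum_card_image f U]
    have hfib : ∀ b ∈ U.image f, (U.filter fun u => f u = b).card = 2 := by
      intro b hb
      obtain ⟨u, hu, rfl⟩ := mem_image.1 hb
      have hset : (U.filter fun u' => f u' = f u) = {u, u * z} := by
        ext u'
        simp only [mem_filter, mem_insert, mem_singleton]
        constructor
        · rintro ⟨-, hu'⟩
          exact fib u u' hu'.symm
        · rintro (rfl | rfl)
          · exact ⟨hu, rfl⟩
          · exact ⟨hUz u hu, by rw [map_mul, hfz, mul_one]⟩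
      rw [hset, card_pair]
      intro heq
      exact hz1 (mul_eq_left.1 heq.symm)
    rw [sum_congr rfl hfib, sum_const, smul_eq_mul, mul_comm]

end DihedralLikeGroup

/-! ## Descent for an abstract presentation -/

section Abstract

variable {A : Type} [AddCommGroup A] [DecidableEq A] [Fintype A] {G : Type} [Group G] [DecidableEq G]
  {ρ τ : A → G} {c₀ : A} {B : Type} [AddCommGroup B] [DecidableEq B] [Fintype B]

/-- **Descent along a central involution.**  Dihedral-like presentation `ρ, τ` over `(A, c₀)`; `z₀ ∈ A` with `2z₀ = 0 ≠ z₀`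
(so `ρ(z₀)` is a central involution; the basic case is `z₀ = c₀`), `π : A →+ B` with kernel `{0, z₀}` and `π c₀ = c₀'`;
a TPP triple `(S, T, U)` of non-empty sets with `U ρ(z₀) = U`.  Then `G(B, c₀')` (`= Dih(B)` when `z₀ = c₀`) has a TPP triple
`(S', T', U')` with `|S'| = |S|`, `|T'| = |T|`, `2|U'| = |U|`, whose coset parts are the `π`-images of the coset parts of
`S, T, U`. [folklore] -/
theorem tpp_descend {c₀' : B} [Fact (c₀' + c₀' = 0)]
    (hρρ : ∀ a b, ρ a * ρ b = ρ (a + b)) (hρτ : ∀ a b, ρ a * τ b = τ (b - a))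
    (hτρ : ∀ a b, τ a * ρ b = τ (a + b)) (hττ : ∀ a b, τ a * τ b = ρ (c₀ + b - a))
    (hρ : Function.Injective ρ) (hτ : Function.Injective τ) (hne : ∀ a b, ρ a ≠ τ b)
    (hsurj : ∀ g, (∃ a, ρ a = g) ∨ (∃ a, τ a = g))
    {z₀ : A} (hz2 : z₀ + z₀ = 0) (hz0 : z₀ ≠ 0)
    (π : A →+ B) (hπc : π c₀ = c₀') (hker : ∀ a : A, π a = 0 ↔ a = 0 ∨ a = z₀)
    {S T U : Finset G} (h : TripleProductProperty S T U) (hS : S.Nonempty) (hT : T.Nonempty) (hU : U.Nonempty)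
    (hUz : ∀ u ∈ U, u * ρ z₀ ∈ U) :
    ∃ S' T' U' : Finset (DihedralLikeGroup B c₀'), TripleProductProperty S' T' U' ∧
      S'.card = S.card ∧ T'.card = T.card ∧ 2 * U'.card = U.card ∧
      ((univ.filter fun b : B => DihedralLikeGroup.rho b ∈ S') = (univ.filter fun a : A => ρ a ∈ S).image π ∧
       (univ.filter fun b : B => DihedralLikeGroup.tau b ∈ S') = (univ.filter fun a : A => τ a ∈ S).image π) ∧
      ((univ.filter fun b : B => DihedralLikeGroup.rho b ∈ T') = (univ.filter fun a : A => ρ a ∈ T).image π ∧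
       (univ.filter fun b : B => DihedralLikeGroup.tau b ∈ T') = (univ.filter fun a : A => τ a ∈ T).image π) ∧
      ((univ.filter fun b : B => DihedralLikeGroup.rho b ∈ U') = (univ.filter fun a : A => ρ a ∈ U).image π ∧
       (univ.filter fun b : B => DihedralLikeGroup.tau b ∈ U') = (univ.filter fun a : A => τ a ∈ U).image π) := by
  have h2c₀ : c₀ + c₀ = 0 := two_c0_eq_zero hρτ hτρ hττ hτ
  haveI : Fact (c₀ + c₀ = 0) := ⟨h2c₀⟩
  have hπz : π z₀ = 0 := (hker z₀).2 (Or.inr rfl)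
  obtain ⟨f, hfρ, hfτ⟩ := DihedralLikeGroup.exists_map (c₀ := c₀) (c₀' := c₀') π hπc
  let eG : DihedralLikeGroup A c₀ ≃* G := DihedralLikeGroup.equivOfPresentation hρρ hρτ hτρ hττ hρ hτ hne hsurj
  have eGρ : ∀ a, eG (DihedralLikeGroup.rho a) = ρ a := fun a => rfl
  have eGτ : ∀ a, eG (DihedralLikeGroup.tau a) = τ a := fun a => rfl
  -- kernel of `f`
  have hkerf : ∀ g : DihedralLikeGroup A c₀, f g = 1 ↔ g = 1 ∨ g = DihedralLikeGroup.rho z₀ := by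
    intro g
    rw [DihedralLikeGroup.one_def, DihedralLikeGroup.one_def]
    cases g with
    | rho a =>
      rw [hfρ]
      constructor
      · intro h1
        have : π a = 0 := DihedralLikeGroup.rho_injective h1
        rcases (hker a).1 this with rfl | rfl
        · exact Or.inl rfl
        · exact Or.inr rfl
      · rintro (h1 | h1)
        · rw [DihedralLikeGroup.rho_injective h1, map_zero]
        · rw [DihedralLikeGroup.rho_injective h1, hπz]
    | tau a =>
      rw [hfτ]
      constructor
      · intro h1; exact absurd h1.symm (DihedralLikeGroup.rho_ne_tau _ _)
      · rintro (h1 | h1) <;> exact absurd h1.symm (DihedralLikeGroup.rho_ne_tau _ _)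
  -- pull the triple back to the model
  set S₁ := S.image eG.symm with hS₁
  set T₁ := T.image eG.symm with hT₁
  set U₁ := U.image eG.symm with hU₁
  obtain ⟨h₁, cS₁, cT₁, cU₁⟩ := tpp_map_mulEquiv eG.symm h
  have hU₁z : ∀ u ∈ U₁, u * DihedralLikeGroup.rho z₀ ∈ U₁ := by
    intro u hu
    obtain ⟨u', hu', rfl⟩ := mem_image.1 hu
    refine mem_image.2 ⟨u' * ρ z₀, hUz u' hu', ?_⟩
    rw [map_mul, ← eGρ z₀, MulEquiv.symm_apply_apply]
  obtain ⟨h₂, cS₂, cT₂, cU₂⟩ := DihedralLikeGroup.tpp_image_of_stable f hz2 hz0 hkerf h₁ (hS.image _) (hT.image _)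
    (hU.image _) hU₁z
  -- coset parts of the images
  have parts : ∀ X : Finset G,
      (univ.filter fun b : B => DihedralLikeGroup.rho b ∈ (X.image eG.symm).image f) =
        (univ.filter fun a : A => ρ a ∈ X).image π ∧
      (univ.filter fun b : B => DihedralLikeGroup.tau b ∈ (X.image eG.symm).image f) =
        (univ.filter fun a : A => τ a ∈ X).image π := by
    intro X
    constructor
    · ext b
      simp only [mem_filter, mem_univ, true_and, mem_image]
      constructor
      · rintro ⟨g, ⟨x, hx, rfl⟩, hgx⟩
        rcases hsurj x with ⟨a, rfl⟩ | ⟨a, rfl⟩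
        · rw [← eGρ, MulEquiv.symm_apply_apply, hfρ] at hgx
          exact ⟨a, hx, DihedralLikeGroup.rho_injective hgx⟩
        · rw [← eGτ, MulEquiv.symm_apply_apply, hfτ] at hgx
          exact absurd hgx.symm (DihedralLikeGroup.rho_ne_tau _ _)
      · rintro ⟨a, ha, rfl⟩
        exact ⟨DihedralLikeGroup.rho a, ⟨ρ a, ha, by rw [← eGρ, MulEquiv.symm_apply_apply]⟩, hfρ a⟩
    · ext b
      simp only [mem_filter, mem_univ, true_and, mem_image]
      constructor
      · rintro ⟨g, ⟨x, hx, rfl⟩, hgx⟩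
        rcases hsurj x with ⟨a, rfl⟩ | ⟨a, rfl⟩
        · rw [← eGρ, MulEquiv.symm_apply_apply, hfρ] at hgx
          exact absurd hgx (DihedralLikeGroup.rho_ne_tau _ _)
        · rw [← eGτ, MulEquiv.symm_apply_apply, hfτ] at hgx
          exact ⟨a, hx, DihedralLikeGroup.tau_injective hgx⟩
      · rintro ⟨a, ha, rfl⟩
        exact ⟨DihedralLikeGroup.tau a, ⟨τ a, ha, by rw [← eGτ, MulEquiv.symm_apply_apply]⟩, hfτ a⟩
  refine ⟨S₁.image f, T₁.image f, U₁.image f, h₂, by rw [cS₂, cS₁], by rw [cT₂, cT₁], by rw [cU₂, cU₁],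
    parts S, parts T, parts U⟩

/-- **Two-domino triples: `|S||T||U| ≤ 2 β(Dih(A/⟨c₀⟩))`.**  Dicyclic type (`c₀ ≠ 0`), `π : A →+ B` onto with kernel
`{0, c₀}`; if `S` and `T` meet each coset in exactly one element, then `Dih(B) = G(B, 0)` has a TPP triple `(S', T', U')` with
`S', T'` again meeting each coset in exactly one element and `|S||T||U| ≤ 2 |S'||T'||U'|`. [folklore] -/
theorem two_domino_volume_le_double
    (hρρ : ∀ a b, ρ a * ρ b = ρ (a + b)) (hρτ : ∀ a b, ρ a * τ b = τ (b - a))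
    (hτρ : ∀ a b, τ a * ρ b = τ (a + b)) (hττ : ∀ a b, τ a * τ b = ρ (c₀ + b - a)) (hc₀ : c₀ ≠ 0)
    (hρ : Function.Injective ρ) (hτ : Function.Injective τ) (hne : ∀ a b, ρ a ≠ τ b)
    (hsurj : ∀ g, (∃ a, ρ a = g) ∨ (∃ a, τ a = g))
    (π : A →+ B) (hker : ∀ a : A, π a = 0 ↔ a = 0 ∨ a = c₀)
    {S T U : Finset G} (h : TripleProductProperty S T U) (hU : U.Nonempty)
    (hs₀ : (univ.filter fun a : A => ρ a ∈ S).card = 1) (hs₁ : (univ.filter fun a : A => τ a ∈ S).card = 1)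
    (ht₀ : (univ.filter fun a : A => ρ a ∈ T).card = 1) (ht₁ : (univ.filter fun a : A => τ a ∈ T).card = 1) :
    ∃ S' T' U' : Finset (DihedralLikeGroup B 0), TripleProductProperty S' T' U' ∧
      (univ.filter fun b : B => DihedralLikeGroup.rho b ∈ S').card = 1 ∧
      (univ.filter fun b : B => DihedralLikeGroup.tau b ∈ S').card = 1 ∧
      (univ.filter fun b : B => DihedralLikeGroup.rho b ∈ T').card = 1 ∧
      (univ.filter fun b : B => DihedralLikeGroup.tau b ∈ T').card = 1 ∧
      S.card * T.card * U.card ≤ 2 * (S'.card * T'.card * U'.card) := by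
  set z : G := ρ c₀ with hz
  have hzc : ∀ g, Commute z g := commute_rho_c0 hρρ hρτ hτρ hττ hτ hsurj
  have hzz : z * z = 1 := rho_c0_mul_self hρρ hρτ hτρ hττ hτ
  have hsat := tpp_saturate hzc hzz (domino_quot_stable hρρ hρτ hτρ hττ hτ hne hsurj hs₀ hs₁)
    (domino_quot_stable hρρ hρτ hτρ hττ hτ hne hsurj ht₀ ht₁) h
  set U₂ := U ∪ U.image (· * z) with hU₂
  have hU₂z : ∀ u ∈ U₂, u * ρ c₀ ∈ U₂ := by
    intro u hu
    rcases mem_union.1 hu with hu | hu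
    · exact mem_union_right _ (mem_image_of_mem _ hu)
    · obtain ⟨u', hu', rfl⟩ := mem_image.1 hu
      rw [← hz, mul_assoc, hzz, mul_one]; exact mem_union_left _ hu'
  have cS : S.card = 2 := by rw [card_eq_parts' hρ hτ hne hsurj S, hs₀, hs₁]
  have cT : T.card = 2 := by rw [card_eq_parts' hρ hτ hne hsurj T, ht₀, ht₁]
  have hSne : S.Nonempty := card_pos.1 (by omega)
  have hTne : T.Nonempty := card_pos.1 (by omega)
  have hU₂ne : U₂.Nonempty := (hU.mono subset_union_left)
  have h2c₀ : c₀ + c₀ = 0 := two_c0_eq_zero hρτ hτρ hττ hτ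
  have hπc : π c₀ = 0 := (hker c₀).2 (Or.inr rfl)
  obtain ⟨S', T', U', h', cS', cT', cU', ⟨pS₀, pS₁⟩, ⟨pT₀, pT₁⟩, -⟩ :=
    tpp_descend hρρ hρτ hτρ hττ hρ hτ hne hsurj h2c₀ hc₀ π hπc hker hsat hSne hTne hU₂ne hU₂z
  -- parts of size one map to parts of size one
  have one_img : ∀ X : Finset A, X.card = 1 → (X.image π).card = 1 := by
    intro X hX; obtain ⟨a, rfl⟩ := card_eq_one.1 hX; rw [image_singleton, card_singleton]
  refine ⟨S', T', U', h', by rw [pS₀]; exact one_img _ hs₀, by rw [pS₁]; exact one_img _ hs₁,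
    by rw [pT₀]; exact one_img _ ht₀, by rw [pT₁]; exact one_img _ ht₁, ?_⟩
  have hUle : U.card ≤ U₂.card := card_le_card subset_union_left
  rw [cS', cT', cS, cT]
  calc 2 * 2 * U.card ≤ 2 * 2 * U₂.card := Nat.mul_le_mul_left _ hUle
    _ = 2 * (2 * 2 * U'.card) := by rw [← cU']; ring

/-- **No two-domino dicyclic-law triple when `A/⟨c₀⟩` maps onto `𝔽₂³`.**  Dicyclic type (`c₀ ≠ 0`), `|A| ≡ 2 (mod 3)`,
`|A| ≥ 28`, `π : A →+ B` onto with kernel `{0, c₀}`, and `B` has three homomorphisms to `ZMod 2` jointly onto `𝔽₂³`.  Then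
no TPP triple with `S`, `T` meeting each coset in one element attains `3|S||T||U| + 16 = 8|A|`: by saturation and descent it
would give a mod-one law triple of `Dih(B)` (`|B| = |A|/2 ≡ 1 (mod 3)`), impossible by `no_mod_one_law_of_rank_three`.
Applies to `C₂² × Q_{4m}` (`m ≡ 4 (mod 6)`), `C₂² × (ℤ_n ⋊ ℤ₄)` (`n ≡ 4 (mod 6)`), `C₂³ × Q_{4m}` (`m ≡ 2 (mod 3)`).
[folklore] -/
theorem no_two_domino_dicyclic_law_of_rank_three
    (hρρ : ∀ a b, ρ a * ρ b = ρ (a + b)) (hρτ : ∀ a b, ρ a * τ b = τ (b - a))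
    (hτρ : ∀ a b, τ a * ρ b = τ (a + b)) (hττ : ∀ a b, τ a * τ b = ρ (c₀ + b - a)) (hc₀ : c₀ ≠ 0)
    (hρ : Function.Injective ρ) (hτ : Function.Injective τ) (hne : ∀ a b, ρ a ≠ τ b)
    (hsurj : ∀ g, (∃ a, ρ a = g) ∨ (∃ a, τ a = g)) (hmod : Fintype.card A % 3 = 2) (hA : 28 ≤ Fintype.card A)
    (π : A →+ B) (hπ : Function.Surjective π) (hker : ∀ a : A, π a = 0 ↔ a = 0 ∨ a = c₀)
    (ψ₁ ψ₂ ψ₃ : B →+ ZMod 2) (hψ : ∀ v : ZMod 2 × ZMod 2 × ZMod 2, ∃ b, (ψ₁ b, ψ₂ b, ψ₃ b) = v)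
    {S T U : Finset G} (h : TripleProductProperty S T U)
    (hs₀ : (univ.filter fun a : A => ρ a ∈ S).card = 1) (hs₁ : (univ.filter fun a : A => τ a ∈ S).card = 1)
    (ht₀ : (univ.filter fun a : A => ρ a ∈ T).card = 1) (ht₁ : (univ.filter fun a : A => τ a ∈ T).card = 1) :
    3 * (S.card * T.card * U.card) + 16 ≠ 8 * Fintype.card A := by
  intro hV
  haveI : Fact ((0 : B) + 0 = 0) := ⟨add_zero 0⟩
  have hcard : Fintype.card A = 2 * Fintype.card B := card_eq_two_mul_of_ker_pair π hπ hc₀ hker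
  have cS : S.card = 2 := by rw [card_eq_parts' hρ hτ hne hsurj S, hs₀, hs₁]
  have cT : T.card = 2 := by rw [card_eq_parts' hρ hτ hne hsurj T, ht₀, ht₁]
  have hU : U.Nonempty := by
    rw [cS, cT] at hV; apply card_pos.1; omega
  obtain ⟨S', T', U', h', -, -, -, -, hvol⟩ :=
    two_domino_volume_le_double hρρ hρτ hτρ hττ hc₀ hρ hτ hne hsurj π hker h hU hs₀ hs₁ ht₀ ht₁
  -- the mod-one law bound in `Dih(B)` and its non-attainment
  have hle := tpp_volume_le_law_dihedralLike_mod_one (A := B) (G := DihedralLikeGroup B 0)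
    (ρ := DihedralLikeGroup.rho) (τ := DihedralLikeGroup.tau) (c₀ := (0 : B))
    DihedralLikeGroup.rho_mul_rho DihedralLikeGroup.rho_mul_tau DihedralLikeGroup.tau_mul_rho
    DihedralLikeGroup.tau_mul_tau DihedralLikeGroup.rho_injective DihedralLikeGroup.tau_injective
    DihedralLikeGroup.rho_ne_tau DihedralLikeGroup.rho_or_tau (by omega) (by omega) h'
  have hne' := no_mod_one_law_of_rank_three (A := B) (G := DihedralLikeGroup B 0)
    (ρ := DihedralLikeGroup.rho) (τ := DihedralLikeGroup.tau) (c₀ := (0 : B))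
    DihedralLikeGroup.rho_mul_rho DihedralLikeGroup.rho_mul_tau DihedralLikeGroup.tau_mul_rho
    DihedralLikeGroup.tau_mul_tau DihedralLikeGroup.rho_injective DihedralLikeGroup.tau_injective
    DihedralLikeGroup.rho_ne_tau DihedralLikeGroup.rho_or_tau (by omega) ψ₁ ψ₂ ψ₃ hψ h'
  omega

end Abstract

end Summit.MatrixMultiplication.OmegaCensus
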